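import Literature.NumberTheory.EllipticCurves.TunnellFormsFrickeProofs
import Literature.NumberTheory.EllipticCurves.TunnellWeightTwoThetaProductsProofs
import Literature.NumberTheory.EllipticCurves.TunnellThmTwoTrivHeckeProofs
import Literature.NumberTheory.EllipticCurves.TunnellFormsAutomorphy
import HarnessLib

/-!
# The Fricke involution on `S_{3/2}(128, χ)`

For `f : ℍ → ℂ` put `(W f)(z) = f(-1/(128 z)) / r(z)³`, `r(z) = (-iz)^{1/2}` (`frickeOp`; the
point `-1/(128z)` and `r` are `frickePt`, `frickeR` of `TunnellFormsFrickeProofs`). This file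
PROVES, in the framework `halfIntModularForms / halfIntCuspForms k N χ` of `HalfIntegralWeightForms`
(weight `k/2 = 3/2`, level `128`):

* `frickeOp_mem_halfIntCuspForms` — **`W` maps `S_{3/2}(128, χ)` into `S_{3/2}(128, χ⁻¹ χ₂)`**
  (`χ₂ = tunnellChar = (2/·)`), and likewise `M_{3/2}` (`frickeOp_mem_halfIntModularForms`).
  Automorphy (`frickeOp_smul`): for `γ = (a b; c d) ∈ Γ₀(128)` one has `W(γz) = γ'(Wz)` with
  `γ' = (d, -c/128; -128b, a) ∈ Γ₀(128)` (`frickeConj`), and the theta multiplier satisfies the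
  exact relation **`j(γ', Wz) r(z) = χ₂(d) j(γ, z) r(γz)`** (`thetaFactor_frickeConj`), obtained
  branch-free from `θ(Wz) = 8 r(z) θ₃₂(z)` (`TunnellFormsFrickeProofs.thetaMul_fricke`), the
  automorphy of `θ₃₂ ∈ M_{1/2}(128, χ₂)` and `θ₃₂ ≢ 0` (identity theorem); hence
  `(Wf)(γz) = χ(a) χ₂(d) j(γ,z)³ (Wf)(z)`. Cusps (`isZeroAtImInfty_slashSq_frickeOp`): for
  `g ∈ SL₂(ℤ)`, `W g = σ (A B; 0 D)` (Hermite form, `exists_SL2_mul_upper`) gives the exact identity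
  `slashSq 3 (Wf) g z = (128/D)³ (-i)⁻³ · slashSq 3 f σ ((Az+B)/D)` (`slashSq_frickeOp`), so the
  cusp conditions of `f` transport.
* `frickeOp_tunnellForm_eight` etc. — the images of Tunnell's forms:
  `W(gθ₈) = 32 gθ₄`, `W(gθ₂) = 64 gθ₁₆`, `W(gθ₃₂) = 16 gθ₁`, `W(g(θ₂ - θ₈)) = 32 (2gθ₁₆ - gθ₄)`.

What is NOT proved here is the compatibility of `W` with the Hecke operators `T(p²)` (Shimura
1973, §1), which together with `TunnellThmTwoOrdinaryProofs.heckeTSq_tunnellForm_eight` would give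
the remaining eigenvalue identifications of Tunnell's Theorem 2 (see the module docstring of
`TunnellFormsFrickeProofs`).

## References

* G. Shimura, *On modular forms of half integral weight*, Ann. of Math. 97 (1973) 440–481, §1.
  [Shimura1973HalfIntegral]
* J. B. Tunnell, *A classical Diophantine problem and modular forms of weight 3/2*, Invent. Math.
  72 (1983) 323–334, p. 327. [Tunnell1983Congruent]
-/

noncomputable section

open scoped MatrixGroups Manifold

open UpperHalfPlane hiding I
open Complex Filter Topology CongruenceSubgroup
open Literature.NumberTheory.EllipticCurves.ModularForms

namespace Literature.NumberTheory.EllipticCurves.Tunnell1983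

/-! ### The operator -/

/-- **The Fricke involution of weight `3/2` and level `128`**: `(W f)(z) = f(-1/(128z)) / r(z)³`,
`r(z) = (-iz)^{1/2}`. [cite: Shimura1973HalfIntegral, §1] -/
def frickeOp (f : ℍ → ℂ) (z : ℍ) : ℂ := f (frickePt z) / frickeR z ^ 3

/-- `r(z) ≠ 0`. [folklore] -/
theorem frickeR_ne_zero (z : ℍ) : frickeR z ≠ 0 := by
  intro h
  have := frickeR_sq z
  rw [h, zero_pow two_ne_zero] at this
  exact mul_ne_zero (neg_ne_zero.mpr I_ne_zero) (UpperHalfPlane.ne_zero z) this.symm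

/-- `W` is linear: `W (f + g) = W f + W g`. [folklore] -/
theorem frickeOp_add (f g : ℍ → ℂ) : frickeOp (f + g) = frickeOp f + frickeOp g := by
  funext z; simp [frickeOp, add_div]

/-- `W (c f) = c W f`. [folklore] -/
theorem frickeOp_smul_const (c : ℂ) (f : ℍ → ℂ) : frickeOp (c • f) = c • frickeOp f := by
  funext z; simp [frickeOp, mul_div_assoc]

/-- `W (f - g) = W f - W g`. [folklore] -/
theorem frickeOp_sub (f g : ℍ → ℂ) : frickeOp (f - g) = frickeOp f - frickeOp g := by
  funext z; simp [frickeOp, sub_div]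

/-! ### Holomorphy -/

/-- `r` is holomorphic on `ℍ` (`-iz` lies in the slit plane). [folklore] -/
theorem mdifferentiable_frickeR : MDiff frickeR := by
  rw [UpperHalfPlane.mdifferentiable_iff]
  intro w hw
  have hw' : 0 < w.im := hw
  have hslit : -I * w ∈ Complex.slitPlane := by
    rw [Complex.mem_slitPlane_iff]
    left
    simpa using hw'
  have hd : DifferentiableAt ℂ (fun w : ℂ ↦ (-I * w) ^ (1 / 2 : ℂ)) w :=
    (differentiableAt_id.const_mul _).cpow_const hslit
  refine (hd.congr_of_eventuallyEq ?_).differentiableWithinAt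
  filter_upwards [isOpen_upperHalfPlaneSet.mem_nhds hw] with u hu
  simp only [Function.comp_apply, frickeR, ofComplex_apply_of_im_pos hu, UpperHalfPlane.coe_mk]

/-- Holomorphic functions compose with `z ↦ -1/(128z)`. [folklore] -/
theorem mdifferentiable_comp_frickePt {F : ℍ → ℂ} (hF : MDiff F) :
    MDiff (fun z : ℍ ↦ F (frickePt z)) := by
  rw [UpperHalfPlane.mdifferentiable_iff] at hF ⊢
  intro w hw
  have hw' : 0 < w.im := hw
  have hmem : (-1 / (128 * w)) ∈ {z : ℂ | 0 < z.im} := im_fricke_pos ⟨w, hw'⟩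
  have hφ : DifferentiableAt ℂ (fun w : ℂ ↦ -1 / (128 * w)) w := by
    have : (128 : ℂ) * w ≠ 0 := mul_ne_zero (by norm_num) (by
      intro h; rw [h] at hw'; simp at hw')
    fun_prop (disch := exact this)
  have hFd : DifferentiableAt ℂ (F ∘ ofComplex) (-1 / (128 * w)) :=
    (hF _ hmem).differentiableAt (isOpen_upperHalfPlaneSet.mem_nhds hmem)
  have hcomp := hFd.comp w hφ
  refine (hcomp.congr_of_eventuallyEq ?_).differentiableWithinAt
  filter_upwards [isOpen_upperHalfPlaneSet.mem_nhds hw] with u hu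
  simp only [Function.comp_apply, ofComplex_apply_of_im_pos hu]
  congr 1
  apply UpperHalfPlane.ext
  rw [coe_frickePt, UpperHalfPlane.coe_mk, ofComplex_apply_of_im_pos (im_fricke_pos ⟨u, hu⟩),
    UpperHalfPlane.coe_mk, UpperHalfPlane.coe_mk]

/-- `W f` is holomorphic when `f` is. [folklore] -/
theorem mdifferentiable_frickeOp {f : ℍ → ℂ} (hf : MDiff f) : MDiff (frickeOp f) := by
  unfold frickeOp
  exact (mdifferentiable_comp_frickePt hf).div (mdifferentiable_frickeR.pow 3)
    (fun z ↦ pow_ne_zero 3 (frickeR_ne_zero z))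

/-! ### `W γ W⁻¹` for `γ ∈ Γ₀(128)` -/

section Conj

variable {γ : SL(2, ℤ)}

/-- `128 ∣ c` for `γ ∈ Γ₀(128)`. [folklore] -/
theorem dvd_c_of_mem (hγ : γ ∈ Gamma0 128) : (128 : ℤ) ∣ γ 1 0 := by
  rw [Gamma0_mem] at hγ
  exact_mod_cast (ZMod.intCast_zmod_eq_zero_iff_dvd (γ 1 0) 128).mp hγ

/-- **`γ' = W γ W⁻¹ = (d, -c/128; -128 b, a)`** for `γ = (a b; c d) ∈ Γ₀(128)`. [folklore] -/
def frickeConj (γ : SL(2, ℤ)) (hγ : γ ∈ Gamma0 128) : SL(2, ℤ) :=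
  ⟨!![γ 1 1, -(γ 1 0 / 128); -(128 * γ 0 1), γ 0 0], by
    rw [Matrix.det_fin_two_of]
    have h := det_entries γ
    have hc : γ 1 0 / 128 * 128 = γ 1 0 := Int.ediv_mul_cancel (dvd_c_of_mem hγ)
    linear_combination h - γ 0 1 * hc⟩

/-- Entries of `γ'`. [folklore] -/
theorem frickeConj_apply (hγ : γ ∈ Gamma0 128) :
    (frickeConj γ hγ) 0 0 = γ 1 1 ∧ (frickeConj γ hγ) 0 1 = -(γ 1 0 / 128) ∧
      (frickeConj γ hγ) 1 0 = -(128 * γ 0 1) ∧ (frickeConj γ hγ) 1 1 = γ 0 0 := by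
  refine ⟨rfl, rfl, rfl, rfl⟩

/-- `γ' ∈ Γ₀(128)`. [folklore] -/
theorem frickeConj_mem (hγ : γ ∈ Gamma0 128) : frickeConj γ hγ ∈ Gamma0 128 := by
  rw [Gamma0_mem, (frickeConj_apply hγ).2.2.1, ZMod.intCast_zmod_eq_zero_iff_dvd]
  exact ⟨-γ 0 1, by ring⟩

/-- **`W(γz) = γ'(Wz)`.** [folklore] -/
theorem frickePt_smul (hγ : γ ∈ Gamma0 128) (z : ℍ) :
    frickePt (γ • z) = frickeConj γ hγ • frickePt z := by
  have hdet := det_entries γ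
  have hc : ((γ 1 0 / 128 : ℤ) : ℂ) * 128 = γ 1 0 := by
    exact_mod_cast Int.ediv_mul_cancel (dvd_c_of_mem hγ)
  have hz := UpperHalfPlane.ne_zero z
  have hden : ((γ 1 0 : ℤ) : ℂ) * z + ((γ 1 1 : ℤ) : ℂ) ≠ 0 :=
    intLinear_ne_zero (by rw [Int.gcd_comm]; exact SL2Z_gcd_eq_one hdet) z
  have hnum : ((γ 0 0 : ℤ) : ℂ) * z + ((γ 0 1 : ℤ) : ℂ) ≠ 0 :=
    intLinear_ne_zero (SL2Z_gcd_eq_one (d := γ 0 0) (c := γ 0 1) (a := γ 1 1) (b := γ 1 0)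
      (by linear_combination hdet)) z
  -- both sides equal `-(cz + d)/(128 (az + b))`
  have hcoe : ((γ • z : ℍ) : ℂ) = (((γ 0 0 : ℤ) : ℂ) * z + ((γ 0 1 : ℤ) : ℂ)) /
      (((γ 1 0 : ℤ) : ℂ) * z + ((γ 1 1 : ℤ) : ℂ)) := by
    rw [coe_specialLinearGroup_apply]
    simp only [eq_intCast]
    push_cast
    ring
  have hL : ((frickePt (γ • z) : ℍ) : ℂ) =
      -(((γ 1 0 : ℤ) : ℂ) * z + ((γ 1 1 : ℤ) : ℂ)) / (128 * (((γ 0 0 : ℤ) : ℂ) * z + ((γ 0 1 : ℤ) : ℂ))) := by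
    rw [coe_frickePt, hcoe, ← mul_div_assoc, div_div_eq_mul_div]
    ring
  have hN' : ((γ 1 1 : ℤ) : ℂ) * (-1 / (128 * (z : ℂ))) + (((-(γ 1 0 / 128) : ℤ)) : ℂ) =
      -(((γ 1 0 : ℤ) : ℂ) * z + ((γ 1 1 : ℤ) : ℂ)) / (128 * z) := by
    push_cast
    rw [← hc]
    field_simp
    ring
  have hD' : (((-(128 * γ 0 1)) : ℤ) : ℂ) * (-1 / (128 * (z : ℂ))) + ((γ 0 0 : ℤ) : ℂ) =
      (((γ 0 0 : ℤ) : ℂ) * z + ((γ 0 1 : ℤ) : ℂ)) / z := by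
    push_cast
    field_simp
    ring
  have hR : ((frickeConj γ hγ • frickePt z : ℍ) : ℂ) =
      -(((γ 1 0 : ℤ) : ℂ) * z + ((γ 1 1 : ℤ) : ℂ)) / (128 * (((γ 0 0 : ℤ) : ℂ) * z + ((γ 0 1 : ℤ) : ℂ))) := by
    rw [coe_specialLinearGroup_apply, coe_frickePt]
    simp only [(frickeConj_apply hγ).1, (frickeConj_apply hγ).2.1, (frickeConj_apply hγ).2.2.1,
      (frickeConj_apply hγ).2.2.2, eq_intCast]
    rw [show (((γ 1 1 : ℤ) : ℝ) : ℂ) = ((γ 1 1 : ℤ) : ℂ) by push_cast; ring,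
      show (((-(γ 1 0 / 128) : ℤ) : ℝ) : ℂ) = (((-(γ 1 0 / 128)) : ℤ) : ℂ) by push_cast; ring,
      show (((-(128 * γ 0 1) : ℤ) : ℝ) : ℂ) = (((-(128 * γ 0 1)) : ℤ) : ℂ) by push_cast; ring,
      show (((γ 0 0 : ℤ) : ℝ) : ℂ) = ((γ 0 0 : ℤ) : ℂ) by push_cast; ring, hN', hD']
    field_simp
  apply UpperHalfPlane.ext
  rw [hL, hR]

end Conj

/-! ### `θ(Wz) = 8 r(z) θ₃₂(z)` and `θ₃₂ ≢ 0` -/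

/-- **`θ(-1/(128z)) = 8 r(z) θ₃₂(z)`.** [folklore] -/
theorem shimuraTheta_frickePt (z : ℍ) : shimuraTheta (frickePt z) = 8 * frickeR z * thetaMul 32 z := by
  rw [← thetaMul_one_eq_shimuraTheta, thetaMul_fricke (t := 1) (s := 32) rfl, sqrt_two_mul_thirtytwo]
  push_cast
  ring

/-- `θ₃₂ ≢ 0` (else `g θ₃₂ = 0`, contradicting the linear independence of `g θ₂, g θ₈, g θ₃₂`).
[folklore] -/
theorem thetaMul_thirtytwo_ne_zero : thetaMul 32 ≠ 0 := by
  intro h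
  have h32 : tunnellForm 32 = 0 := by
    funext z
    simp [tunnellForm, h]
  have := linearIndependent_tunnellForm_triv.ne_zero 2
  exact this (by simpa using h32)

/-- Division by `θ₃₂` through the identity theorem. [folklore] -/
theorem eq_zero_of_mul_thetaMul_thirtytwo {G : ℍ → ℂ} (hG : MDiff G)
    (h : ∀ z, G z * thetaMul 32 z = 0) : G = 0 := by
  have hθ : MDiff (thetaMul 32) := (thetaMul_mem_halfIntModularForms_chi2 (Or.inr (Or.inr rfl))).1
  have hprod : G * thetaMul 32 = 0 := funext fun z ↦ h z
  rcases (UpperHalfPlane.mul_eq_zero_iff hG hθ).mp hprod with h0 | h0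
  · exact h0
  · exact absurd h0 thetaMul_thirtytwo_ne_zero

/-! ### The multiplier relation `j(γ', Wz) r(z) = χ₂(d) j(γ, z) r(γz)` -/

section Multiplier

variable {γ : SL(2, ℤ)}

/-- **`j(γ', Wz) · r(z) = χ₂(d) · j(γ, z) · r(γz)`** for `γ ∈ Γ₀(128)`, `γ' = WγW⁻¹`, with the
principal branches throughout: multiply by `8 θ₃₂(z)` — the left side becomes
`j(γ', Wz) θ(Wz) = θ(γ' Wz) = θ(W γz) = 8 r(γz) θ₃₂(γz) = 8 r(γz) χ₂(d) j(γ,z) θ₃₂(z)` — and cancel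
`θ₃₂ ≢ 0` by the identity theorem. [cite: Shimura1973HalfIntegral, §1] -/
theorem thetaFactor_frickeConj (hγ : γ ∈ Gamma0 128) (z : ℍ) :
    thetaFactor ((frickeConj γ hγ) 1 0) ((frickeConj γ hγ) 1 1) (frickePt z) * frickeR z =
      tunnellChar ((γ 1 1 : ℤ) : ZMod 128) * thetaFactor (γ 1 0) (γ 1 1) z * frickeR (γ • z) := by
  have hN : 4 ∣ 128 := by norm_num
  set G : ℍ → ℂ := fun z ↦ thetaFactor ((frickeConj γ hγ) 1 0) ((frickeConj γ hγ) 1 1) (frickePt z) *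
      frickeR z - tunnellChar ((γ 1 1 : ℤ) : ZMod 128) * thetaFactor (γ 1 0) (γ 1 1) z * frickeR (γ • z)
    with hGdef
  have hGd : MDiff G := by
    refine ((mdifferentiable_comp_frickePt (mdifferentiable_thetaFactor _ _)).mul
      mdifferentiable_frickeR).sub ?_
    exact (mdifferentiable_const.mul (mdifferentiable_thetaFactor _ _)).mul
      ((mdifferentiable_frickeR).comp (UpperHalfPlane.mdifferentiable_smul (by simp)))
  have h32 := thetaMul_mem_halfIntModularForms_chi2 (Or.inr (Or.inr rfl))
  have h0 := eq_zero_of_mul_thetaMul_thirtytwo hGd (fun w ↦ by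
    -- `θ(γ' W w) = j(γ', Ww) θ(Ww)` and `θ(γ' W w) = θ(W γ w) = 8 r(γw) θ₃₂(γw)`
    have h1 := shimuraTheta_smul_eq_thetaFactor hN (frickeConj_mem hγ) (frickePt w)
    rw [← frickePt_smul hγ w, shimuraTheta_frickePt, shimuraTheta_frickePt] at h1
    -- `θ₃₂(γw) = χ₂(d) j(γ, w) θ₃₂(w)`
    have h2 := apply_smul_eq_of_mem hN h32 hγ w
    simp only [autFactor, pow_one] at h2
    rw [h2] at h1
    simp only [hGdef]
    linear_combination (-1 / 8 : ℂ) * h1)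
  have := congrFun h0 z
  simpa only [hGdef, Pi.zero_apply, sub_eq_zero] using this

end Multiplier

/-! ### Automorphy of `W f` -/

section Automorphy

variable {χ : DirichletCharacter ℂ 128} {γ : SL(2, ℤ)}

/-- `χ(a) = χ⁻¹(d)` for `(a b; c d) ∈ Γ₀(128)` (`ad ≡ 1`). [folklore] -/
theorem chi_a_eq_inv_d (hγ : γ ∈ Gamma0 128) :
    χ ((γ 0 0 : ℤ) : ZMod 128) = χ⁻¹ ((γ 1 1 : ℤ) : ZMod 128) := by
  have hdet := det_entries γ
  obtain ⟨c', hc'⟩ := dvd_c_of_mem hγ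
  have had : ((γ 0 0 : ℤ) : ZMod 128) * ((γ 1 1 : ℤ) : ZMod 128) = 1 := by
    have : ((γ 0 0 * γ 1 1 : ℤ) : ZMod 128) = ((1 + γ 0 1 * (128 * c') : ℤ) : ZMod 128) := by
      congr 1; rw [← hc']; linarith
    rw [← Int.cast_mul, this]
    push_cast
    rw [show (128 : ZMod 128) = 0 from rfl]
    ring
  have hu : IsUnit ((γ 1 1 : ℤ) : ZMod 128) := isUnit_iff_exists_inv.mpr ⟨_, by rw [mul_comm]; exact had⟩
  rw [MulChar.inv_apply_eq_inv']
  have hχ : χ ((γ 0 0 : ℤ) : ZMod 128) * χ ((γ 1 1 : ℤ) : ZMod 128) = 1 := by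
    rw [← map_mul, had, map_one]
  have hne : χ ((γ 1 1 : ℤ) : ZMod 128) ≠ 0 := fun h ↦ by rw [h, mul_zero] at hχ; exact zero_ne_one hχ
  field_simp
  exact hχ

/-- `χ₂(x)² = 1` for a unit `x` modulo `128` (`χ₂ = χ₈` takes the values `±1` on odd residues).
[folklore] -/
theorem tunnellChar_sq_of_isUnit {x : ZMod 128} (hx : IsUnit x) : tunnellChar x ^ 2 = 1 := by
  obtain ⟨u, rfl⟩ := hx
  have hcop : ((u : ZMod 128).val).Coprime 128 := ZMod.val_coe_unit_coprime u
  rw [← ZMod.natCast_zmod_val (u : ZMod 128), tunnellChar_natCast hcop]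
  have hodd : (u : ZMod 128).val % 2 = 1 := by
    by_contra hne
    have h2 : 2 ∣ (u : ZMod 128).val := Nat.dvd_of_mod_eq_zero (by omega)
    have hg := Nat.dvd_gcd h2 (by norm_num : 2 ∣ 128)
    rw [hcop.gcd_eq_one] at hg
    exact absurd (Nat.le_of_dvd one_pos hg) (by norm_num)
  rw [ZMod.χ₈_nat_eq_if_mod_eight, if_neg (by omega)]
  split_ifs <;> norm_num

/-- `d` is a unit modulo `128` for `(a b; c d) ∈ Γ₀(128)`. [folklore] -/
theorem isUnit_d (hγ : γ ∈ Gamma0 128) : IsUnit ((γ 1 1 : ℤ) : ZMod 128) := by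
  have hdet := det_entries γ
  obtain ⟨c', hc'⟩ := dvd_c_of_mem hγ
  have had : ((γ 1 1 : ℤ) : ZMod 128) * ((γ 0 0 : ℤ) : ZMod 128) = 1 := by
    have : ((γ 1 1 * γ 0 0 : ℤ) : ZMod 128) = ((1 + γ 0 1 * (128 * c') : ℤ) : ZMod 128) := by
      congr 1; rw [← hc']; linarith
    rw [← Int.cast_mul, this]
    push_cast
    rw [show (128 : ZMod 128) = 0 from rfl]
    ring
  exact isUnit_iff_exists_inv.mpr ⟨_, had⟩

/-- **Automorphy of `W f`**: for `f ∈ M_{3/2}(128, χ)` and `γ = (a b; c d) ∈ Γ₀(128)`,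
`(Wf)(γz) = χ⁻¹(d) χ₂(d) j(γ, z)³ (Wf)(z)`. [cite: Shimura1973HalfIntegral, §1] -/
theorem frickeOp_smul {f : ℍ → ℂ} (hf : f ∈ halfIntModularForms 3 128 χ) (hγ : γ ∈ Gamma0 128) (z : ℍ) :
    frickeOp f (γ • z) = autFactor 3 128 (χ⁻¹ * tunnellChar) γ z * frickeOp f z := by
  have hN : 4 ∣ 128 := by norm_num
  have h1 := apply_smul_eq_of_mem hN hf (frickeConj_mem hγ) (frickePt z)
  rw [← frickePt_smul hγ z] at h1
  have hkey := thetaFactor_frickeConj hγ z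
  have hr := frickeR_ne_zero z
  have hrγ := frickeR_ne_zero (γ • z)
  have hsq := tunnellChar_sq_of_isUnit (isUnit_d hγ)
  have hχa := chi_a_eq_inv_d (χ := χ) hγ
  have c10 : (frickeConj γ hγ) 1 0 = -(128 * γ 0 1) := (frickeConj_apply hγ).2.2.1
  have c11 : (frickeConj γ hγ) 1 1 = γ 0 0 := (frickeConj_apply hγ).2.2.2
  unfold frickeOp
  rw [h1]
  simp only [autFactor, MulChar.mul_apply]
  rw [c10, c11] at hkey ⊢
  rw [hχa]
  -- replace `j(γ', Wz)` using the key relation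
  have hj : thetaFactor (-(128 * γ 0 1)) (γ 0 0) (frickePt z) =
      tunnellChar ((γ 1 1 : ℤ) : ZMod 128) * thetaFactor (γ 1 0) (γ 1 1) z * frickeR (γ • z) / frickeR z := by
    rw [← hkey, mul_div_cancel_right₀ _ hr]
  rw [hj]
  field_simp
  -- `χ₂(d)³ = χ₂(d)`
  linear_combination (χ⁻¹ ((γ 1 1 : ℤ) : ZMod 128)) * thetaFactor (γ 1 0) (γ 1 1) z ^ 3 *
    f (frickePt z) * tunnellChar ((γ 1 1 : ℤ) : ZMod 128) * hsq

/-- `W f` is theta-automorphic of weight `3/2`, level `128`, character `χ⁻¹ χ₂`. [folklore] -/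
theorem isThetaAutomorphic_frickeOp {f : ℍ → ℂ} (hf : f ∈ halfIntModularForms 3 128 χ) :
    IsThetaAutomorphic 3 128 (χ⁻¹ * tunnellChar) (frickeOp f) :=
  isThetaAutomorphic_of_apply_smul_eq (by norm_num) fun _ hγ z ↦ frickeOp_smul hf hγ z

end Automorphy

/-! ### The cusp conditions of `W f` -/

section Cusps

/-- `(az + b) ≠ 0` for `(a b; c d) ∈ SL₂(ℤ)` and `z ∈ ℍ`. [folklore] -/
theorem num_ne_zero (g : SL(2, ℤ)) (z : ℍ) : ((g 0 0 : ℤ) : ℂ) * z + ((g 0 1 : ℤ) : ℂ) ≠ 0 := by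
  have hdet := det_entries g
  intro h
  have him := congrArg Complex.im h
  simp only [Complex.add_im, Complex.mul_im, Complex.intCast_re, Complex.intCast_im, zero_mul,
    add_zero, Complex.zero_im] at him
  have hzim := z.im_pos
  have ha : ((g 0 0 : ℤ) : ℝ) = 0 := by
    by_contra hne
    exact absurd him (mul_ne_zero hne hzim.ne')
  have ha' : g 0 0 = 0 := by exact_mod_cast ha
  have hre := congrArg Complex.re h
  simp only [Complex.add_re, Complex.mul_re, Complex.intCast_re, Complex.intCast_im, zero_mul,
    sub_zero, Complex.zero_re, ha, zero_add] at hre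
  have hb : g 0 1 = 0 := by exact_mod_cast hre
  rw [ha', hb] at hdet
  simp at hdet

/-- **`slashSq` of `W f` at a cusp**: if `W g = σ (A B; 0 D)` (Hermite form of
`(-c, -d; 128a, 128b)`), then `slashSq 3 (Wf) g z = (128/D)³ (-i)⁻³ slashSq 3 f σ ((Az+B)/D)`.
[folklore] -/
theorem slashSq_frickeOp (f : ℍ → ℂ) (g : SL(2, ℤ)) :
    ∃ (σ : SL(2, ℤ)) (A B D : ℤ) (hA : 0 < A) (hD : 0 < D), ∀ z : ℍ,
      slashSq 3 (frickeOp f) g z =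
        ((128 : ℂ) / D) ^ 3 / (-I) ^ 3 * slashSq 3 f σ (affinePt B hA hD z) := by
  have hdet := det_entries g
  obtain ⟨σ, A, B, D, hA, hD, h00, h01, h10, h11⟩ := exists_SL2_mul_upper
    (-g 1 0) (-g 1 1) (128 * g 0 0) (128 * g 0 1) (by nlinarith)
  have hdetσ := det_entries σ
  refine ⟨σ, A, B, D, hA, hD, fun z ↦ ?_⟩
  have hD0 : (D : ℂ) ≠ 0 := by exact_mod_cast hD.ne'
  have hA0 : (A : ℂ) ≠ 0 := by exact_mod_cast hA.ne'
  have hz := UpperHalfPlane.ne_zero z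
  have hnum := num_ne_zero g z
  have hden : ((g 1 0 : ℤ) : ℂ) * z + ((g 1 1 : ℤ) : ℂ) ≠ 0 :=
    intLinear_ne_zero (by rw [Int.gcd_comm]; exact SL2Z_gcd_eq_one hdet) z
  -- the entries of `g` through `σ, A, B, D`
  have e00 : ((-g 1 0 : ℤ) : ℂ) = σ 0 0 * A := by exact_mod_cast h00
  have e01 : ((-g 1 1 : ℤ) : ℂ) = σ 0 0 * B + σ 0 1 * D := by exact_mod_cast h01
  have e10 : ((128 * g 0 0 : ℤ) : ℂ) = σ 1 0 * A := by exact_mod_cast h10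
  have e11 : ((128 * g 0 1 : ℤ) : ℂ) = σ 1 0 * B + σ 1 1 * D := by exact_mod_cast h11
  push_cast at e00 e01 e10 e11
  have f10 : ((g 1 0 : ℤ) : ℂ) = -(((σ 0 0 : ℤ) : ℂ) * A) := by linear_combination -e00
  have f11 : ((g 1 1 : ℤ) : ℂ) = -(((σ 0 0 : ℤ) : ℂ) * B + ((σ 0 1 : ℤ) : ℂ) * D) := by
    linear_combination -e01
  have f00 : ((g 0 0 : ℤ) : ℂ) = ((σ 1 0 : ℤ) : ℂ) * A / 128 := by linear_combination e10 / 128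
  have f01 : ((g 0 1 : ℤ) : ℂ) = (((σ 1 0 : ℤ) : ℂ) * B + ((σ 1 1 : ℤ) : ℂ) * D) / 128 := by
    linear_combination e11 / 128
  have hdenσ' : ((σ 1 0 : ℤ) : ℂ) * (((A : ℂ) * z + B) / D) + ((σ 1 1 : ℤ) : ℂ) ≠ 0 := by
    have := intLinear_ne_zero (by rw [Int.gcd_comm]; exact SL2Z_gcd_eq_one hdetσ) (affinePt B hA hD z)
    rwa [coe_affinePt] at this
  -- the point: `W(gz) = σ ((Az+B)/D)`
  have hpt : frickePt (g • z) = σ • affinePt B hA hD z := by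
    apply UpperHalfPlane.ext
    rw [coe_frickePt, coe_specialLinearGroup_apply, coe_specialLinearGroup_apply, coe_affinePt]
    simp only [eq_intCast]
    push_cast
    have hnum' := hnum
    have hden' := hden
    rw [f00, f01] at hnum'
    rw [f10, f11] at hden'
    rw [f10, f11, f00, f01]
    have hnum'' : (z : ℂ) * (((σ 1 0 : ℤ) : ℂ) * A / 128) + (((σ 1 0 : ℤ) : ℂ) * B + ((σ 1 1 : ℤ) : ℂ) * D) / 128 ≠ 0 := by
      rwa [mul_comm] at hnum'
    have hden'' : (z : ℂ) * -(((σ 0 0 : ℤ) : ℂ) * A) + -(((σ 0 0 : ℤ) : ℂ) * B + ((σ 0 1 : ℤ) : ℂ) * D) ≠ 0 := by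
      rwa [mul_comm] at hden'
    field_simp
    ring
  -- `denom(σ, u) = 128 (az+b)/D`
  have hdenσ : ((σ 1 0 : ℤ) : ℂ) * ((affinePt B hA hD z : ℍ) : ℂ) + ((σ 1 1 : ℤ) : ℂ) =
      128 * (((g 0 0 : ℤ) : ℂ) * z + ((g 0 1 : ℤ) : ℂ)) / D := by
    rw [coe_affinePt, f00, f01]
    field_simp
    ring
  -- `↑(gz)`, the two denominators, and `r(gz)⁶ = (-i gz)³`
  have hcoe : ((g • z : ℍ) : ℂ) = (((g 0 0 : ℤ) : ℂ) * z + ((g 0 1 : ℤ) : ℂ)) /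
      (((g 1 0 : ℤ) : ℂ) * z + ((g 1 1 : ℤ) : ℂ)) := by
    rw [coe_specialLinearGroup_apply]
    simp only [eq_intCast]
    push_cast
    ring
  have hdg : denom (g : GL (Fin 2) ℝ) z = ((g 1 0 : ℤ) : ℂ) * z + ((g 1 1 : ℤ) : ℂ) := by
    rw [ModularGroup.denom_apply]
  have hdσ : denom (σ : GL (Fin 2) ℝ) (affinePt B hA hD z) =
      128 * (((g 0 0 : ℤ) : ℂ) * z + ((g 0 1 : ℤ) : ℂ)) / D := by
    rw [← hdenσ, ModularGroup.denom_apply]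
  have hr6 : frickeR (g • z) ^ 6 = (-I * ((g • z : ℍ) : ℂ)) ^ 3 := by
    rw [show (6 : ℕ) = 2 * 3 by rfl, pow_mul, frickeR_sq]
  -- assemble
  simp only [slashSq, frickeOp]
  rw [hpt, div_pow, ← pow_mul, show 3 * 2 = 6 by rfl, hr6, hdg, hdσ, hcoe]
  have hI3 : (-I : ℂ) ^ 3 ≠ 0 := pow_ne_zero 3 (neg_ne_zero.mpr I_ne_zero)
  have hI : (-I : ℂ) ≠ 0 := neg_ne_zero.mpr I_ne_zero
  have hnum2 : (z : ℂ) * ((g 0 0 : ℤ) : ℂ) + ((g 0 1 : ℤ) : ℂ) ≠ 0 := by rwa [mul_comm] at hnum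
  have hden2 : (z : ℂ) * ((g 1 0 : ℤ) : ℂ) + ((g 1 1 : ℤ) : ℂ) ≠ 0 := by rwa [mul_comm] at hden
  field_simp

/-- `Im ((Az+B)/D) → ∞` as `Im z → ∞`. [folklore] -/
theorem tendsto_affinePt {A B D : ℤ} (hA : 0 < A) (hD : 0 < D) :
    Tendsto (affinePt B hA hD) atImInfty atImInfty := by
  simp only [atImInfty, tendsto_comap_iff, Function.comp_def]
  have h : ∀ z : ℍ, UpperHalfPlane.im (affinePt B hA hD z) = (A : ℝ) / D * z.im := fun z ↦ by
    show (((affinePt B hA hD z : ℍ) : ℂ)).im = _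
    rw [coe_affinePt, im_affine hD]
  simp_rw [h]
  exact Tendsto.const_mul_atTop (div_pos (Int.cast_pos.mpr hA) (Int.cast_pos.mpr hD)) tendsto_comap

/-- **`W f` vanishes at every cusp** when `f` does. [folklore] -/
theorem isZeroAtImInfty_slashSq_frickeOp {f : ℍ → ℂ}
    (hf : ∀ σ : SL(2, ℤ), IsZeroAtImInfty (slashSq 3 f σ)) (g : SL(2, ℤ)) :
    IsZeroAtImInfty (slashSq 3 (frickeOp f) g) := by
  obtain ⟨σ, A, B, D, hA, hD, h⟩ := slashSq_frickeOp f g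
  have h' : slashSq 3 (frickeOp f) g =
      (((128 : ℂ) / D) ^ 3 / (-I) ^ 3) • (slashSq 3 f σ ∘ affinePt B hA hD) := by
    funext z; rw [h z, Pi.smul_apply, smul_eq_mul, Function.comp_apply]
  rw [h']
  exact ZeroAtFilter.smul _ ((hf σ).comp (tendsto_affinePt hA hD))

/-- **`W f` is bounded at every cusp** when `f` is. [folklore] -/
theorem isBoundedAtImInfty_slashSq_frickeOp {f : ℍ → ℂ}
    (hf : ∀ σ : SL(2, ℤ), IsBoundedAtImInfty (slashSq 3 f σ)) (g : SL(2, ℤ)) :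
    IsBoundedAtImInfty (slashSq 3 (frickeOp f) g) := by
  obtain ⟨σ, A, B, D, hA, hD, h⟩ := slashSq_frickeOp f g
  have h' : slashSq 3 (frickeOp f) g =
      (((128 : ℂ) / D) ^ 3 / (-I) ^ 3) • (slashSq 3 f σ ∘ affinePt B hA hD) := by
    funext z; rw [h z, Pi.smul_apply, smul_eq_mul, Function.comp_apply]
  rw [h']
  have hb : IsBoundedAtImInfty (slashSq 3 f σ ∘ affinePt B hA hD) :=
    (hf σ).comp_tendsto (tendsto_affinePt hA hD)
  exact hb.const_smul_left _

end Cusps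

/-! ### `W : S_{3/2}(128, χ) → S_{3/2}(128, χ⁻¹ χ₂)` -/

/-- **The Fricke involution maps `M_{3/2}(128, χ)` into `M_{3/2}(128, χ⁻¹ χ₂)`.**
[cite: Shimura1973HalfIntegral, §1] -/
theorem frickeOp_mem_halfIntModularForms {χ : DirichletCharacter ℂ 128} {f : ℍ → ℂ}
    (hf : f ∈ halfIntModularForms 3 128 χ) :
    frickeOp f ∈ halfIntModularForms 3 128 (χ⁻¹ * tunnellChar) :=
  ⟨mdifferentiable_frickeOp hf.1, isThetaAutomorphic_frickeOp hf,
    isBoundedAtImInfty_slashSq_frickeOp hf.2.2⟩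

/-- **The Fricke involution maps `S_{3/2}(128, χ)` into `S_{3/2}(128, χ⁻¹ χ₂)`.**
[cite: Shimura1973HalfIntegral, §1] -/
theorem frickeOp_mem_halfIntCuspForms {χ : DirichletCharacter ℂ 128} {f : ℍ → ℂ}
    (hf : f ∈ halfIntCuspForms 3 128 χ) :
    frickeOp f ∈ halfIntCuspForms 3 128 (χ⁻¹ * tunnellChar) :=
  ⟨mdifferentiable_frickeOp hf.1,
    isThetaAutomorphic_frickeOp (halfIntCuspForms_le_halfIntModularForms 3 128 χ hf),
    isZeroAtImInfty_slashSq_frickeOp hf.2.2⟩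

/-! ### The images of Tunnell's forms -/

/-- **`W(gθ₈) = 32 gθ₄`.** [cite: Tunnell1983Congruent, p. 327] -/
theorem frickeOp_tunnellForm_eight : frickeOp (tunnellForm 8) = (32 : ℂ) • tunnellForm 4 := by
  funext z
  have hr := frickeR_ne_zero z
  rw [frickeOp, tunnellForm_eight_fricke, Pi.smul_apply, smul_eq_mul]
  field_simp

/-- **`W(gθ₂) = 64 gθ₁₆`.** [cite: Tunnell1983Congruent, p. 327] -/
theorem frickeOp_tunnellForm_two : frickeOp (tunnellForm 2) = (64 : ℂ) • tunnellForm 16 := by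
  funext z
  have hr := frickeR_ne_zero z
  rw [frickeOp, tunnellForm_two_fricke, Pi.smul_apply, smul_eq_mul]
  field_simp

/-- **`W(gθ₃₂) = 16 gθ₁`.** [cite: Tunnell1983Congruent, p. 327] -/
theorem frickeOp_tunnellForm_thirtytwo : frickeOp (tunnellForm 32) = (16 : ℂ) • tunnellForm 1 := by
  funext z
  have hr := frickeR_ne_zero z
  rw [frickeOp, tunnellForm_thirtytwo_fricke, Pi.smul_apply, smul_eq_mul]
  field_simp

/-- **`W(g(θ₂ - θ₈)) = 32 (2 gθ₁₆ - gθ₄)`**: the class-`3` eigenline of `S_{3/2}(128, 1)` goes to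
the line of `gθ₄ - 2gθ₁₆`. [cite: Tunnell1983Congruent, Thm 2 and p. 327] -/
theorem frickeOp_tunnellForm_two_sub_eight (z : ℍ) :
    frickeOp (tunnellForm 2 - tunnellForm 8) z = 32 * (2 * tunnellForm 16 z - tunnellForm 4 z) := by
  rw [frickeOp_sub, frickeOp_tunnellForm_two, frickeOp_tunnellForm_eight]
  simp only [Pi.smul_apply, Pi.sub_apply, smul_eq_mul]
  ring

end Literature.NumberTheory.EllipticCurves.Tunnell1983
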